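import Literature.AlgebraicGeometry.Motives.AbelianVarietyImage
import Literature.AlgebraicGeometry.Motives.AbelianVarietyTorsionCubeProofs
import Literature.AlgebraicGeometry.Motives.TateAbelianFiniteLatticeProofs
import Literature.NumberTheory.DiophantineGeometry.AVIsogenyTateHomPoincareProofs
import HarnessLib

/-!
# Poincaré complements from quasi-retractions (Mumford §19, proof of Thm. 1 / Cor. 2; any field)

Let `K` be any field, `i : Y ⟶ X` a homomorphism of abelian varieties over `K` and `h : X ⟶ Y` a
**quasi-retraction** of `i`: `i ≫ h = N • 𝟙 Y` (`h ∘ i = [N]_Y`) for some integer `N ≥ 1`. Put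
`v = N • 𝟙 X - h ≫ i ∈ End X` (so that `u = h ≫ i` satisfies `u² = N u`, `u v = v u = 0`,
`u + v = [N]_X`: `u / N` and `v / N` are complementary idempotents of `End⁰ X`), and let
`Z = im v ↪ X` be the image abelian subvariety (`AbelianVariety.image`, `imageι`, any field).
**Then `(i, j) : Y ⊞ Z ⟶ X` is an isogeny**, with the explicit two-sided quasi-inverse
`(h, v) : X ⟶ Y ⊞ Z`:

* `AbelianVariety.lift_desc_eq_nsmul_of_quasiRetraction` — `(h, v̄) ≫ (i, j) = N • 𝟙 X`;
* `AbelianVariety.desc_lift_eq_nsmul_of_quasiRetraction` — `(i, j) ≫ (h, v̄) = N • 𝟙 (Y ⊞ Z)`;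
* `AbelianVariety.isIsogeny_desc_of_quasiRetraction` — `biprod.desc i (imageι v)` is an isogeny,
  and `AbelianVariety.isIsogeny_lift_of_quasiRetraction` — so is `biprod.lift h (toImage v)`;
* `AbelianVariety.dim_add_dim_image_of_quasiRetraction` — `dim Y + dim Z = dim X`;
* `AbelianVariety.exists_complement_of_quasiRetraction` — **the Poincaré complement packaged**:
  `∃ Z (j : Z ⟶ X), IsClosedImmersion j ∧ IsIsogeny (biprod.desc i j) ∧ j ≫ h = 0 ∧
   dim Y + dim Z = dim X`, together with a two-sided quasi-inverse.

This is the algebraic half of Poincaré's complete reducibility theorem: once an abelian subvariety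
`Y ⊂ X` admits a quasi-retraction over `K`, a complement exists over `K`, in every characteristic
and without any hypothesis on `K`. (Mumford, *Abelian Varieties*, §19: the idempotent calculus of
the proof of Cor. 2 of Thm. 1, p. 174, run backwards; Milne 1986, Prop. 12.1, where the complement
is produced over an arbitrary field from an ample sheaf and the dual abelian variety — the tree has
no dual abelian variety, and the present dual-free form is what the Galois-descent proof of
Poincaré's theorem over perfect fields, `Motives/AbelianVarietyPoincarePerfectField`, consumes.)
The multiplications `[N]` are isogenies in every characteristic by `isIsogeny_zsmul_id_holds`
(`Motives/AbelianVarietyTorsionCubeProofs`, from the Theorem of the Cube), so no invertibility of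
`N` in `K` is required.

Also recorded, for homomorphisms of abelian varieties over any field: a surjective homomorphism is
an epimorphism of `AbelianVariety K` (`epi_of_surjective_toSchemeHom`, Mathlib
`ext_of_isDominant_of_isSeparated`, Görtz–Wedhorn I Cor. 9.9) and a closed-immersion homomorphism
is a monomorphism (`mono_of_isClosedImmersion_toSchemeHom`, Görtz–Wedhorn I Cor. 12.92). The four matrix entries
`i ≫ h = N`, `i ≫ v̄ = 0`, `j ≫ h = 0`, `j ≫ v̄ = N` of `(i, j) ≫ (h, v̄)` are private lemmas.

Everything is proved; no definition, no named fact (D-0026).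

## References

* D. Mumford, *Abelian Varieties*, TIFR Studies in Math. 5 (1970), §19, Thm. 1 and the proof of
  its Cor. 2 (pp. 173–174); Remark p. 169 (quasi-inverse of an isogeny). [MumfordAV1970]
* J. S. Milne, *Abelian Varieties*, in Cornell–Silverman (eds.), *Arithmetic Geometry*, Springer
  (1986), Prop. 12.1, p. 122 (held copy `book:cornellnd-arithmetic-geometry`, PDF p. 189: stated
  over an arbitrary ground field). [Milne1986AbelianVarieties]
* U. Görtz, T. Wedhorn, *Algebraic Geometry I: Schemes*, 2nd ed., Springer (2020): Cor. 9.9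
  (morphisms agreeing on a dense open of a reduced scheme), Cor. 12.92 (closed immersions are the
  proper monomorphisms) — held copy `book:gortz2020-algebraic-geometry-i-schemes-2nd-ed`, PDF
  pp. 283, 455. [GortzWedhorn2020]
-/

noncomputable section

universe u

open CategoryTheory CategoryTheory.Limits AlgebraicGeometry

namespace Literature.AlgebraicGeometry.Motives

namespace AbelianVariety

variable {K : Type u} [Field K]

/-! ### Surjective homomorphisms are epimorphisms; closed immersions are monomorphisms -/

/-- **A surjective homomorphism of abelian varieties is an epimorphism** of `AbelianVariety K`:
`t ≫ a = t ≫ b` with `t` surjective forces `a = b` (the source of `a`, `b` is integral, the target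
is separated over `K`, and a surjective morphism is dominant; Mathlib
`ext_of_isDominant_of_isSeparated`; Görtz–Wedhorn I, Cor. 9.9: morphisms from a reduced scheme to
a scheme separated over the base which agree on a dense open coincide). [cite: GortzWedhorn2020, Cor. 9.9] -/
theorem epi_of_surjective_toSchemeHom {W Y : AbelianVariety K} (t : W ⟶ Y)
    [Surjective (Hom.toSchemeHom t)] : Epi t := by
  refine ⟨fun {Z} a b h ↦ ?_⟩
  apply AbelianVariety.hom_ext _ _ (Over.OverMorphism.ext ?_)
  haveI : IsIntegral Y.X.left := GeometricallyIntegral.isIntegral_of_subsingleton Y.X.hom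
  change Hom.toSchemeHom a = Hom.toSchemeHom b
  refine ext_of_isDominant_of_isSeparated Z.X.hom ?_ (Hom.toSchemeHom t) ?_
  · rw [Over.w a.hom.hom.hom, Over.w b.hom.hom.hom]
  · change Hom.toSchemeHom (t ≫ a) = Hom.toSchemeHom (t ≫ b)
    rw [h]

/-- **A closed-immersion homomorphism of abelian varieties is a monomorphism** of
`AbelianVariety K`: `a ≫ j = b ≫ j` with `j` a closed immersion forces `a = b` (a closed immersion
is a (proper) monomorphism of schemes, Görtz–Wedhorn I, Cor. 12.92; Mathlib `cancel_mono`).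
[cite: GortzWedhorn2020, Cor. 12.92] -/
theorem mono_of_isClosedImmersion_toSchemeHom {Y Z : AbelianVariety K} (j : Y ⟶ Z)
    [IsClosedImmersion (Hom.toSchemeHom j)] : Mono j := by
  refine ⟨fun {W} a b h ↦ ?_⟩
  apply AbelianVariety.hom_ext _ _ (Over.OverMorphism.ext ?_)
  change Hom.toSchemeHom a = Hom.toSchemeHom b
  rw [← cancel_mono (Hom.toSchemeHom j)]
  exact congrArg Hom.toSchemeHom h

/-- `[N]_X = N • 𝟙 X` is an isogeny for every natural number `N ≠ 0`, in every characteristic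
(`isIsogeny_zsmul_id_holds`, from the Theorem of the Cube). [cite: MumfordAV1970, §6 Application 3 (Prop. p. 64)] -/
theorem isIsogeny_nsmul_id_of_ne_zero (X : AbelianVariety K) {N : ℕ} (hN : N ≠ 0) :
    IsIsogeny (N • 𝟙 X) := by
  have h := isIsogeny_zsmul_id_holds X (N : ℤ) (by exact_mod_cast hN)
  rwa [natCast_zsmul] at h

/-! ### The complement attached to a quasi-retraction -/

section QuasiRetraction

variable {X Y : AbelianVariety K} {i : Y ⟶ X} {h : X ⟶ Y} {N : ℕ}

/-- `i ≫ v = 0` for `v = N • 𝟙 X - h ≫ i` and a quasi-retraction `i ≫ h = N • 𝟙 Y`. [folklore] -/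
private theorem comp_sub_eq_zero_of_quasiRetraction (hih : i ≫ h = N • 𝟙 Y) :
    i ≫ (N • 𝟙 X - h ≫ i) = 0 := by
  rw [Preadditive.comp_sub, Preadditive.comp_nsmul, Category.comp_id, ← Category.assoc, hih,
    Preadditive.nsmul_comp, Category.id_comp, sub_self]

/-- `v ≫ h = 0` for `v = N • 𝟙 X - h ≫ i` and a quasi-retraction `i ≫ h = N • 𝟙 Y`. [folklore] -/
private theorem sub_comp_eq_zero_of_quasiRetraction (hih : i ≫ h = N • 𝟙 Y) :
    (N • 𝟙 X - h ≫ i) ≫ h = 0 := by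
  rw [Preadditive.sub_comp, Preadditive.nsmul_comp, Category.id_comp, Category.assoc, hih,
    Preadditive.comp_nsmul, Category.comp_id, sub_self]

/-- `v ≫ v = N • v` for `v = N • 𝟙 X - h ≫ i`: `v / N` is an idempotent of `End⁰ X`. [folklore] -/
private theorem sub_comp_sub_of_quasiRetraction (hih : i ≫ h = N • 𝟙 Y) :
    (N • 𝟙 X - h ≫ i) ≫ (N • 𝟙 X - h ≫ i) = N • (N • 𝟙 X - h ≫ i) := by
  conv_lhs => rw [Preadditive.sub_comp, Category.assoc, comp_sub_eq_zero_of_quasiRetraction hih,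
    comp_zero, sub_zero, Preadditive.nsmul_comp, Category.id_comp]

/-- **`i ≫ v̄ = 0`**, where `v̄ = toImage v : X ⟶ im v` (`v = N • 𝟙 X - h ≫ i`): the abelian
subvariety `Y` is killed by the projection to the complement (cancel the closed immersion
`im v ↪ X`). [folklore] -/
private theorem comp_toImage_eq_zero_of_quasiRetraction (hih : i ≫ h = N • 𝟙 Y) :
    i ≫ toImage (N • 𝟙 X - h ≫ i) = 0 := by
  haveI := mono_of_isClosedImmersion_toSchemeHom (imageι (N • 𝟙 X - h ≫ i))
  rw [← cancel_mono (imageι (N • 𝟙 X - h ≫ i)), Category.assoc, toImage_imageι,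
    comp_sub_eq_zero_of_quasiRetraction hih, zero_comp]

/-- **`j ≫ h = 0`**, where `j = imageι v : im v ⟶ X`: the complement is killed by the
quasi-retraction (cancel the surjection `X ↠ im v`). [folklore] -/
private theorem imageι_comp_eq_zero_of_quasiRetraction (hih : i ≫ h = N • 𝟙 Y) :
    imageι (N • 𝟙 X - h ≫ i) ≫ h = 0 := by
  haveI := epi_of_surjective_toSchemeHom (toImage (N • 𝟙 X - h ≫ i))
  rw [← cancel_epi (toImage (N • 𝟙 X - h ≫ i)), ← Category.assoc, toImage_imageι,
    sub_comp_eq_zero_of_quasiRetraction hih, comp_zero]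

/-- **`j ≫ v̄ = N • 𝟙 (im v)`**: on the complement, `v` is multiplication by `N` (cancel the
closed immersion `j`, using `v ≫ v = N • v`). [folklore] -/
private theorem imageι_comp_toImage_of_quasiRetraction (hih : i ≫ h = N • 𝟙 Y) :
    imageι (N • 𝟙 X - h ≫ i) ≫ toImage (N • 𝟙 X - h ≫ i) = N • 𝟙 (image (N • 𝟙 X - h ≫ i)) := by
  haveI := mono_of_isClosedImmersion_toSchemeHom (imageι (N • 𝟙 X - h ≫ i))
  haveI := epi_of_surjective_toSchemeHom (toImage (N • 𝟙 X - h ≫ i))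
  rw [← cancel_mono (imageι (N • 𝟙 X - h ≫ i)), ← cancel_epi (toImage (N • 𝟙 X - h ≫ i))]
  calc toImage (N • 𝟙 X - h ≫ i) ≫ (imageι (N • 𝟙 X - h ≫ i) ≫ toImage (N • 𝟙 X - h ≫ i)) ≫
        imageι (N • 𝟙 X - h ≫ i)
      = (toImage (N • 𝟙 X - h ≫ i) ≫ imageι (N • 𝟙 X - h ≫ i)) ≫
          (toImage (N • 𝟙 X - h ≫ i) ≫ imageι (N • 𝟙 X - h ≫ i)) := by
        simp only [Category.assoc]
    _ = N • (toImage (N • 𝟙 X - h ≫ i) ≫ imageι (N • 𝟙 X - h ≫ i)) := by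
        rw [toImage_imageι, sub_comp_sub_of_quasiRetraction hih]
    _ = toImage (N • 𝟙 X - h ≫ i) ≫ (N • 𝟙 (image (N • 𝟙 X - h ≫ i))) ≫
          imageι (N • 𝟙 X - h ≫ i) := by
        rw [Preadditive.nsmul_comp, Category.id_comp, Preadditive.comp_nsmul]

/-- **`(h, v̄) ≫ (i, j) = N • 𝟙 X`**: the first quasi-inverse identity,
`biprod.lift h v̄ ≫ biprod.desc i j = h ≫ i + v = [N]_X`. [cite: MumfordAV1970, §19 proof of Cor. 2 of Thm. 1 (p. 174)] -/
theorem lift_desc_eq_nsmul_of_quasiRetraction (i : Y ⟶ X) (h : X ⟶ Y) (N : ℕ) :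
    biprod.lift h (toImage (N • 𝟙 X - h ≫ i)) ≫ biprod.desc i (imageι (N • 𝟙 X - h ≫ i)) =
      N • 𝟙 X := by
  rw [biprod.lift_desc, toImage_imageι, add_sub_cancel]

/-- **`(i, j) ≫ (h, v̄) = N • 𝟙 (Y ⊞ Z)`**: the second quasi-inverse identity (the four entries
`i ≫ h = N`, `i ≫ v̄ = 0`, `j ≫ h = 0`, `j ≫ v̄ = N`). [cite: MumfordAV1970, §19 proof of Cor. 2 of Thm. 1 (p. 174)] -/
theorem desc_lift_eq_nsmul_of_quasiRetraction (hih : i ≫ h = N • 𝟙 Y) :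
    biprod.desc i (imageι (N • 𝟙 X - h ≫ i)) ≫ biprod.lift h (toImage (N • 𝟙 X - h ≫ i)) =
      N • 𝟙 (Y ⊞ image (N • 𝟙 X - h ≫ i)) := by
  apply biprod.hom_ext' <;> apply biprod.hom_ext
  · simp only [biprod.inl_desc_assoc, Category.assoc, biprod.lift_fst, hih,
      Preadditive.comp_nsmul, Category.comp_id, Preadditive.nsmul_comp, biprod.inl_fst]
  · simp only [biprod.inl_desc_assoc, Category.assoc, biprod.lift_snd,
      comp_toImage_eq_zero_of_quasiRetraction hih, Preadditive.comp_nsmul, Category.comp_id,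
      Preadditive.nsmul_comp, biprod.inl_snd, smul_zero]
  · simp only [biprod.inr_desc_assoc, Category.assoc, biprod.lift_fst,
      imageι_comp_eq_zero_of_quasiRetraction hih, Preadditive.comp_nsmul, Category.comp_id,
      Preadditive.nsmul_comp, biprod.inr_fst, smul_zero]
  · simp only [biprod.inr_desc_assoc, Category.assoc, biprod.lift_snd,
      imageι_comp_toImage_of_quasiRetraction hih, Preadditive.comp_nsmul, Category.comp_id,
      Preadditive.nsmul_comp, biprod.inr_snd]

/-- **The sum map `(i, j) : Y ⊞ im v ⟶ X` is an isogeny** for a quasi-retraction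
`i ≫ h = N • 𝟙 Y`, `N ≠ 0` (two-sided quasi-inverse `(h, v̄)` and `[N]` an isogeny,
`isIsogeny_of_comp_eq_of_comp_eq`). [cite: MumfordAV1970, §19 Thm. 1 (p. 173)] -/
theorem isIsogeny_desc_of_quasiRetraction (hN : N ≠ 0) (hih : i ≫ h = N • 𝟙 Y) :
    IsIsogeny (biprod.desc i (imageι (N • 𝟙 X - h ≫ i))) :=
  isIsogeny_of_comp_eq_of_comp_eq (isIsogeny_nsmul_id_of_ne_zero X hN)
    (isIsogeny_nsmul_id_of_ne_zero _ hN) (lift_desc_eq_nsmul_of_quasiRetraction i h N)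
    (desc_lift_eq_nsmul_of_quasiRetraction hih)

/-- **The projection `(h, v̄) : X ⟶ Y ⊞ im v` is an isogeny** as well (same two identities,
read the other way). [cite: MumfordAV1970, §19 Thm. 1 and Remark p. 169] -/
theorem isIsogeny_lift_of_quasiRetraction (hN : N ≠ 0) (hih : i ≫ h = N • 𝟙 Y) :
    IsIsogeny (biprod.lift h (toImage (N • 𝟙 X - h ≫ i))) :=
  isIsogeny_of_comp_eq_of_comp_eq (isIsogeny_nsmul_id_of_ne_zero _ hN)
    (isIsogeny_nsmul_id_of_ne_zero X hN) (desc_lift_eq_nsmul_of_quasiRetraction hih)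
    (lift_desc_eq_nsmul_of_quasiRetraction i h N)

/-- **`dim Y + dim (im v) = dim X`** for a quasi-retraction `i ≫ h = N • 𝟙 Y`, `N ≠ 0`
(`dim_biprod`, `dim_eq_of_isIsogeny`). [cite: MumfordAV1970, §19 Thm. 1 (p. 173)] -/
theorem dim_add_dim_image_of_quasiRetraction (hN : N ≠ 0) (hih : i ≫ h = N • 𝟙 Y) :
    Y.dim + (image (N • 𝟙 X - h ≫ i)).dim = X.dim := by
  rw [← dim_biprod]
  exact dim_eq_of_isIsogeny (isIsogeny_desc_of_quasiRetraction hN hih)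

end QuasiRetraction

/-- **Poincaré complement from a quasi-retraction (any field).** Let `i : Y ⟶ X` be a
homomorphism of abelian varieties over a field `K` admitting a quasi-retraction `h : X ⟶ Y`,
`i ≫ h = N • 𝟙 Y` with `N ≠ 0`. Then there are an abelian subvariety `j : Z ↪ X` (a closed
immersion) such that `(i, j) : Y ⊞ Z ⟶ X` is an isogeny, with `j ≫ h = 0`,
`dim Y + dim Z = dim X`, and a homomorphism `t : X ⟶ Z` such that `(h, t)` is a two-sided
quasi-inverse: `(h, t) ≫ (i, j) = N • 𝟙 X` and `(i, j) ≫ (h, t) = N • 𝟙 (Y ⊞ Z)`.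
(`Z = im (N • 𝟙 X - h ≫ i)`, `t` the corestriction.) [cite: MumfordAV1970, §19 Thm. 1 and proof of Cor. 2 (pp. 173–174)]
[cite: Milne1986AbelianVarieties, Prop. 12.1 (p. 122)] -/
theorem exists_complement_of_quasiRetraction {X Y : AbelianVariety K} (i : Y ⟶ X) (h : X ⟶ Y)
    {N : ℕ} (hN : N ≠ 0) (hih : i ≫ h = N • 𝟙 Y) :
    ∃ (Z : AbelianVariety K) (j : Z ⟶ X) (t : X ⟶ Z), IsClosedImmersion (Hom.toSchemeHom j) ∧
      IsIsogeny (biprod.desc i j) ∧ j ≫ h = 0 ∧ Y.dim + Z.dim = X.dim ∧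
      biprod.lift h t ≫ biprod.desc i j = N • 𝟙 X ∧
      biprod.desc i j ≫ biprod.lift h t = N • 𝟙 (Y ⊞ Z) :=
  ⟨image (N • 𝟙 X - h ≫ i), imageι _, toImage _, inferInstance,
    isIsogeny_desc_of_quasiRetraction hN hih, imageι_comp_eq_zero_of_quasiRetraction hih,
    dim_add_dim_image_of_quasiRetraction hN hih, lift_desc_eq_nsmul_of_quasiRetraction i h N,
    desc_lift_eq_nsmul_of_quasiRetraction hih⟩

end AbelianVariety

end Literature.AlgebraicGeometry.Motives
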